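import Mathlib
import Summits.ValiantsHypothesis.ValiantsHypothesis.Theses.FermionicJet
import Literature.Computability.AlgebraicComplexity.FermionicPencil
import Literature.Computability.AlgebraicComplexity.StandardFamiliesProofs
import Literature.Computability.AlgebraicComplexity.ArithCircuitProofs
import Literature.Computability.AlgebraicComplexity.HamiltonianCycleVNP
import Literature.Computability.AlgebraicComplexity.RealTauConjectureDepthFour
import HarnessLib

/-!
# Route FermionicJet, support item `PencilControlsHC` (stmt-ValiantsHypothesis-5349)

The item: if the fermionic pencil with the coupling `t` an extra VARIABLE,
`P_n = ∑_σ sgn σ · T^{c(σ)} ∏ᵢ X_{σ i, i} ∈ ℂ[T, X_{ij}]` (the `(n² + 1)`-variable fermionant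
polynomial of Björklund–Kaski–Williams; the tree's
`Literature.Computability.AlgebraicComplexity.fermionicPencilVar (Fin n) ℂ`, which is the route's
inline term by `rfl`), is a `VP` family, then so is the Hamiltonian cycle family `HC_n`
(`hcPoly (Fin n) ℂ`).

Proof (as in the route text): `[T^1] P_n = ∑_{c(σ) = 1} sgn σ · x^σ = (-1)^{n-1} HC_n` for `n ≥ 2`
(a permutation with exactly one cycle, fixed points counted, is a full cycle, of sign `(-1)^{n-1}`;
`HC_0 = HC_1 = 0` by the tree's edge convention), and a `T`-coefficient of a polynomial of
`T`-degree `≤ d` is extracted by interpolation at the `d + 1` nodes `0, 1, …, d`: each node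
evaluation `T ↦ u` is a Valiant projection (free), the weights are a row of the inverse
Vandermonde matrix, so `L([T^m] f) ≤ (d + 1) · (L(f) + 1) + (d + 1)`
(`complexity_coeff_optionEquivLeft_le`, stated for any `f : MvPolynomial (Option σ) k` over a
field of characteristic zero — the reusable interpolation lemma the route asks for). With
`d = n` this gives `L(HC_n) ≤ (n + 1)(L(P_n) + 1) + (n + 1) + 1`, p-bounded when `L(P_n)` is;
`HC` is a p-family by `isPFamily_hcPoly_holds`.

Contents: `aeval_optionElim_eq_eval_optionEquivLeft` (node evaluation = evaluation of
`optionEquivLeft f` at `C u`), `exists_interpolation_weights` (inverse Vandermonde row),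
`coeff_optionEquivLeft_eq_sum_smul_aeval` (the interpolation identity),
`complexity_coeff_optionEquivLeft_le` (the cost bound), `numCycles_eq_one_iff`,
`coeff_optionEquivLeft_fermionicPencilVar` (`[T^m] P = ∑_{c(σ) = m} sgn σ · x^σ`),
`hcPoly_eq_C_mul_coeff_one`, `complexity_hcPoly_le`, and the item `pencilControlsHC_proof`.

References: Bürgisser 2000, §2.1 (cost of sums / scalar multiples, projections are free);
de Rugy-Altherre 2013 (arXiv:1309.2156) §3 and Björklund–Kaski–Williams 2019 §1.2 (the pencil);
the Vandermonde step is folklore (cf. `exists_dual_weights` in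
`Literature.Computability.AlgebraicComplexity.DepthThreeChasmAlgebra`).
-/

noncomputable section

-- single-conjunct layout: Sub = Summit, duplicated namespace component intended
set_option linter.dupNamespace false

namespace Summit.ValiantsHypothesis.ValiantsHypothesis.Theorems.FermionicJetPencilControlsHC

open MvPolynomial Literature.Computability.AlgebraicComplexity

section Interpolation

variable {k : Type*} [Field k] {σ : Type*}

/-- **Node evaluation.** Substituting the constant `a` for the distinguished variable `T = X none`
and `X s` for `X (some s)` is the same as evaluating the univariate polynomial
`optionEquivLeft k σ f ∈ (MvPolynomial σ k)[T]` at `T = C a` (both are `k`-algebra maps agreeing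
on the variables). -/
theorem aeval_optionElim_eq_eval_optionEquivLeft (a : k) (f : MvPolynomial (Option σ) k) :
    aeval (fun o : Option σ => o.elim (C a) X) f =
      Polynomial.eval (C a) (optionEquivLeft k σ f) := by
  have key : (aeval (fun o : Option σ => o.elim (C a) X) :
        MvPolynomial (Option σ) k →ₐ[k] MvPolynomial σ k) =
      ((Polynomial.aeval (C a : MvPolynomial σ k)).restrictScalars k).comp
        (optionEquivLeft k σ).toAlgHom := by
    refine MvPolynomial.algHom_ext fun o => ?_
    cases o with
    | none => simp [optionEquivLeft_X_none]
    | some s => simp [optionEquivLeft_X_some]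
  have h := congrArg (fun φ : MvPolynomial (Option σ) k →ₐ[k] MvPolynomial σ k => φ f) key
  simpa [Polynomial.coe_aeval_eq_eval] using h

/-- A node evaluation `T ↦ a`, `X (some s) ↦ X s` is a Valiant projection of `f` (every variable
goes to a variable or a constant; Bürgisser 2000, Def. 2.6(1)). -/
theorem isProjection_aeval_optionElim (a : k) (f : MvPolynomial (Option σ) k) :
    IsProjection (aeval (fun o : Option σ => o.elim (C a) X) f) f := by
  refine ⟨fun o : Option σ => o.elim (C a) X, fun o => ?_, rfl⟩
  cases o with
  | none => exact Or.inr ⟨a, rfl⟩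
  | some s => exact Or.inl ⟨s, rfl⟩

/-- Node evaluations are free: `L(f(a, X)) ≤ L(f)` (projections do not increase the circuit
complexity, `IsProjection.complexity_le_holds`; Bürgisser 2000, Rem. 2.7). -/
theorem complexity_aeval_optionElim_le (a : k) (f : MvPolynomial (Option σ) k) :
    complexity (aeval (fun o : Option σ => o.elim (C a) X) f) ≤ complexity f :=
  IsProjection.complexity_le_holds (isProjection_aeval_optionElim a f)

/-- **Interpolation weights.** Over a field of characteristic zero, for the nodes `0, 1, …, d` and
any `m` there are weights `β₀, …, β_d` with `∑_u β_u u^e = [e = m]` for all `e ≤ d` (the `m`-th row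
of the inverse Vandermonde matrix; for `m > d` the right-hand side is `0` and `β = 0` works).
Folklore; the proof follows `exists_dual_weights` of `DepthThreeChasmAlgebra.lean`. -/
theorem exists_interpolation_weights [CharZero k] (d m : ℕ) :
    ∃ β : Fin (d + 1) → k, ∀ e : Fin (d + 1),
      ∑ u : Fin (d + 1), β u * ((u : ℕ) : k) ^ (e : ℕ) = if (e : ℕ) = m then 1 else 0 := by
  set v : Fin (d + 1) → k := fun u => ((u : ℕ) : k) with hv
  have hinj : Function.Injective v := by
    intro a b hab
    simp only [hv, Nat.cast_inj] at hab
    exact Fin.ext hab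
  have hdet : (Matrix.vandermonde v).det ≠ 0 := Matrix.det_vandermonde_ne_zero_iff.2 hinj
  have hunit : IsUnit (Matrix.vandermonde v) :=
    (Matrix.isUnit_iff_isUnit_det _).2 (isUnit_iff_ne_zero.2 hdet)
  obtain ⟨β, hβ⟩ := (Matrix.vecMul_surjective_iff_isUnit.2 hunit)
    (fun e : Fin (d + 1) => if (e : ℕ) = m then (1 : k) else 0)
  refine ⟨β, fun e => ?_⟩
  have h2 : Matrix.vecMul β (Matrix.vandermonde v) e =
      if (e : ℕ) = m then (1 : k) else 0 := congrFun hβ e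
  rw [Matrix.vecMul_apply_eq_sum] at h2
  simpa [Matrix.vandermonde_apply, hv] using h2

/-- **The interpolation identity.** If `f ∈ k[T, X_σ]` has `T`-degree `≤ d` and `β` are
interpolation weights for the nodes `0, …, d` and the index `m` (`exists_interpolation_weights`),
then the `T^m`-coefficient of `f` is the weighted sum of the `d + 1` node evaluations:
`[T^m] f = ∑_u β_u · f(u, X)` (expand `f(u, X) = ∑_{e ≤ d} [T^e] f · u^e` and swap the sums). -/
theorem coeff_optionEquivLeft_eq_sum_smul_aeval (f : MvPolynomial (Option σ) k) {d : ℕ}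
    (hd : (optionEquivLeft k σ f).natDegree ≤ d) (m : ℕ) {β : Fin (d + 1) → k}
    (hβ : ∀ e : Fin (d + 1),
      ∑ u : Fin (d + 1), β u * ((u : ℕ) : k) ^ (e : ℕ) = if (e : ℕ) = m then 1 else 0) :
    (optionEquivLeft k σ f).coeff m =
      ∑ u : Fin (d + 1), β u • aeval (fun o : Option σ => o.elim (C ((u : ℕ) : k)) X) f := by
  set p := optionEquivLeft k σ f with hp
  have hlt : p.natDegree < d + 1 := Nat.lt_succ_of_le hd
  -- expand each node evaluation
  have hev : ∀ u : Fin (d + 1), aeval (fun o : Option σ => o.elim (C ((u : ℕ) : k)) X) f =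
      ∑ e : Fin (d + 1), p.coeff e * C (((u : ℕ) : k) ^ (e : ℕ)) := by
    intro u
    rw [aeval_optionElim_eq_eval_optionEquivLeft, ← hp, Polynomial.eval_eq_sum_range' hlt,
      Finset.sum_range (fun i => p.coeff i * C ((u : ℕ) : k) ^ i)]
    simp only [map_pow]
  simp_rw [hev, Finset.smul_sum]
  rw [Finset.sum_comm]
  have hinner : ∀ e : Fin (d + 1),
      ∑ u : Fin (d + 1), β u • (p.coeff e * C (((u : ℕ) : k) ^ (e : ℕ))) =
        p.coeff e * C (∑ u : Fin (d + 1), β u * ((u : ℕ) : k) ^ (e : ℕ)) := by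
    intro e
    rw [map_sum, Finset.mul_sum]
    refine Finset.sum_congr rfl fun u _ => ?_
    rw [smul_eq_C_mul, map_mul]
    ring
  simp_rw [hinner, hβ]
  by_cases hm : m < d + 1
  · rw [Finset.sum_eq_single (⟨m, hm⟩ : Fin (d + 1))]
    · simp
    · intro e _ hne
      have : (e : ℕ) ≠ m := fun h => hne (Fin.ext h)
      simp [this]
    · intro h
      exact absurd (Finset.mem_univ _) h
  · have hzero : p.coeff m = 0 := by
      apply Polynomial.coeff_eq_zero_of_natDegree_lt
      omega
    rw [hzero]
    symm
    refine Finset.sum_eq_zero fun e _ => ?_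
    have : (e : ℕ) ≠ m := fun h => hm (h ▸ e.isLt)
    simp [this]

/-- **Extracting a `T`-coefficient costs a factor `O(d)`.** Over a field of characteristic zero,
if `f ∈ k[T, X_σ]` (`T = X none`) has `T`-degree `≤ d`, then every coefficient polynomial
`[T^m] f ∈ k[X_σ]` has circuit complexity `L([T^m] f) ≤ (d + 1) · (L(f) + 1) + (d + 1)`:
interpolate at the nodes `0, …, d` (`coeff_optionEquivLeft_eq_sum_smul_aeval`); each node
evaluation is a projection (cost `≤ L(f)`), each weight one scalar gate, and the `d + 1` summands
are added with `d + 1` further gates (`complexity_sum_le_of_le`; Bürgisser 2000, §2.1). This is the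
reusable interpolation lemma named in the route text of item `PencilControlsHC`. -/
theorem complexity_coeff_optionEquivLeft_le [CharZero k] (f : MvPolynomial (Option σ) k) {d : ℕ}
    (hd : (optionEquivLeft k σ f).natDegree ≤ d) (m : ℕ) :
    complexity ((optionEquivLeft k σ f).coeff m) ≤ (d + 1) * (complexity f + 1) + (d + 1) := by
  obtain ⟨β, hβ⟩ := exists_interpolation_weights (k := k) d m
  rw [coeff_optionEquivLeft_eq_sum_smul_aeval f hd m hβ]
  have h := complexity_sum_le_of_le (Finset.univ : Finset (Fin (d + 1)))
    (fun u => β u • aeval (fun o : Option σ => o.elim (C ((u : ℕ) : k)) X) f)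
    (complexity f + 1) fun u _ =>
      (complexity_smul_le_holds _ _).trans
        (Nat.add_le_add_right (complexity_aeval_optionElim_le _ f) 1)
  simpa only [Finset.card_univ, Fintype.card_fin] using h

end Interpolation

/-! ### The pencil: `[T^m]` of the variable-coupling pencil, and `HC_n` as `± [T^1]` -/

section Pencil

/-- On `n ≥ 2` points, a permutation has exactly one cycle (fixed points counted as cycles,
`Equiv.Perm.numCycles`) iff it is a full cycle (`cycleType = {n}`): one nontrivial cycle and no
fixed point forces the cycle to have length `#support = n`, while no nontrivial cycle and one
fixed point forces `n = 1`. -/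
theorem numCycles_eq_one_iff {n : ℕ} (hn : 2 ≤ n) (σ : Equiv.Perm (Fin n)) :
    σ.numCycles = 1 ↔ σ.cycleType = {Fintype.card (Fin n)} := by
  constructor
  · intro h
    rw [Equiv.Perm.numCycles_eq] at h
    have hsum := σ.sum_cycleType
    have hle : σ.support.card ≤ Fintype.card (Fin n) := Finset.card_le_univ _
    rw [Fintype.card_fin] at hle h ⊢
    rcases Nat.eq_zero_or_pos (Multiset.card σ.cycleType) with h0 | hpos
    · exfalso
      have h1 : σ = 1 := Equiv.Perm.cycleType_eq_zero.1 (Multiset.card_eq_zero.1 h0)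
      subst h1
      rw [Equiv.Perm.support_one, Finset.card_empty] at h
      omega
    · have hc : Multiset.card σ.cycleType = 1 := by omega
      obtain ⟨l, hl⟩ := Multiset.card_eq_one.1 hc
      rw [hl, Multiset.sum_singleton] at hsum
      rw [hl, Multiset.singleton_inj]
      omega
  · exact Equiv.Perm.numCycles_of_cycleType_eq σ

variable (n : Type*) [Fintype n] [DecidableEq n] (k : Type*) [CommRing k]

/-- The variable-coupling pencil as a univariate polynomial in `T` over `k[X_{ij}]`:
`P = ∑_σ C(sgn σ · ∏ᵢ X_{σ i, i}) · T^{c(σ)}`. -/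
theorem optionEquivLeft_fermionicPencilVar :
    optionEquivLeft k (n × n) (fermionicPencilVar n k) =
      ∑ σ : Equiv.Perm n, Polynomial.C (C ((Equiv.Perm.sign σ : ℤ) : k) * ∏ i, X (σ i, i)) *
        Polynomial.X ^ σ.numCycles := by
  unfold fermionicPencilVar
  simp only [map_sum, map_mul, map_pow, map_prod, optionEquivLeft_C, optionEquivLeft_X_none,
    optionEquivLeft_X_some]
  refine Finset.sum_congr rfl fun σ _ => ?_
  ring

/-- The pencil has `T`-degree at most `card n` (a permutation has at most `card n` cycles,
`Equiv.Perm.numCycles_le_card`). -/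
theorem natDegree_optionEquivLeft_fermionicPencilVar_le :
    (optionEquivLeft k (n × n) (fermionicPencilVar n k)).natDegree ≤ Fintype.card n := by
  rw [optionEquivLeft_fermionicPencilVar]
  refine Polynomial.natDegree_sum_le_of_forall_le _ _ fun σ _ => ?_
  exact (Polynomial.natDegree_C_mul_X_pow_le _ _).trans (Equiv.Perm.numCycles_le_card σ)

/-- **The cycle-format sums are the `T`-coefficients of the pencil**:
`[T^m] P = ∑_{σ : c(σ) = m} sgn σ · ∏ᵢ X_{σ i, i}` (de Rugy-Altherre 2013, §3, the sums `c_m`, here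
signed). -/
theorem coeff_optionEquivLeft_fermionicPencilVar (m : ℕ) :
    (optionEquivLeft k (n × n) (fermionicPencilVar n k)).coeff m =
      ∑ σ ∈ Finset.univ.filter (fun σ : Equiv.Perm n => σ.numCycles = m),
        C ((Equiv.Perm.sign σ : ℤ) : k) * ∏ i, X (σ i, i) := by
  rw [optionEquivLeft_fermionicPencilVar, Polynomial.finsetSum_coeff, Finset.sum_filter]
  refine Finset.sum_congr rfl fun σ _ => ?_
  rw [Polynomial.coeff_C_mul_X_pow]
  by_cases h : σ.numCycles = m
  · rw [if_pos h.symm, if_pos h]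
  · rw [if_neg (Ne.symm h), if_neg h]

variable {n k}

/-- **`HC_n = (-1)^{n-1} · [T^1] P_n` for `n ≥ 2`**: the permutations with exactly one cycle are
the full cycles (`numCycles_eq_one_iff`), each of sign `(-1)^{n-1}`
(`Equiv.Perm.sign_eq_neg_one_pow_card_sub_numCycles`), and `((-1)^{n-1})² = 1`. -/
theorem hcPoly_eq_C_mul_coeff_one {n : ℕ} (hn : 2 ≤ n) :
    hcPoly (Fin n) ℂ = C ((-1 : ℂ) ^ (n - 1)) *
      (optionEquivLeft ℂ (Fin n × Fin n) (fermionicPencilVar (Fin n) ℂ)).coeff 1 := by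
  rw [coeff_optionEquivLeft_fermionicPencilVar, Finset.mul_sum]
  unfold hcPoly Matrix.hamiltonianCycleSum
  have hfilter : Finset.univ.filter
      (fun π : Equiv.Perm (Fin n) => π.cycleType = {Fintype.card (Fin n)}) =
      Finset.univ.filter (fun σ : Equiv.Perm (Fin n) => σ.numCycles = 1) := by
    ext σ
    simp only [Finset.mem_filter, Finset.mem_univ, true_and, numCycles_eq_one_iff hn]
  rw [hfilter]
  refine Finset.sum_congr rfl fun σ hσ => ?_
  rw [Finset.mem_filter] at hσ
  have hsign : ((Equiv.Perm.sign σ : ℤ) : ℂ) = (-1 : ℂ) ^ (n - 1) := by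
    have h := Equiv.Perm.sign_eq_neg_one_pow_card_sub_numCycles σ
    rw [hσ.2, Fintype.card_fin] at h
    have h' := congrArg (Int.cast : ℤ → ℂ) h
    push_cast at h'
    exact h'
  rw [hsign, ← mul_assoc, ← map_mul, ← pow_add, ← two_mul, pow_mul, neg_one_sq, one_pow, map_one,
    one_mul]
  simp [Matrix.mvPolynomialX_apply]

/-- **Cost of `HC_n` in terms of the pencil**: `L(HC_n) ≤ (n + 1) · (L(P_n) + 1) + (n + 1) + 1`
for every `n` — for `n ≥ 2` by `hcPoly_eq_C_mul_coeff_one` (one scalar gate) and the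
interpolation bound `complexity_coeff_optionEquivLeft_le` with `d = n`; for `n ≤ 1`, `HC_n = 0`
is free. -/
theorem complexity_hcPoly_le (n : ℕ) :
    complexity (hcPoly (Fin n) ℂ) ≤
      (n + 1) * (complexity (fermionicPencilVar (Fin n) ℂ) + 1) + (n + 1) + 1 := by
  rcases lt_or_ge n 2 with hn | hn
  · rw [hcPoly_fin_eq_zero_of_le_one ℂ (by omega), ← C_0, complexity_C_holds]
    exact Nat.zero_le _
  · rw [hcPoly_eq_C_mul_coeff_one hn, ← smul_eq_C_mul]
    refine (complexity_smul_le_holds _ _).trans (Nat.add_le_add_right ?_ 1)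
    have hd := natDegree_optionEquivLeft_fermionicPencilVar_le (Fin n) ℂ
    rw [Fintype.card_fin] at hd
    exact complexity_coeff_optionEquivLeft_le _ hd 1

end Pencil

/-! ### The item -/

/-- **Item `PencilControlsHC` (stmt-ValiantsHypothesis-5349, route FermionicJet).** If the
variable-coupling fermionic pencil `P_n = ∑_σ sgn σ · T^{c(σ)} ∏ᵢ X_{σ i, i}` (in the `n² + 1`
variables `Option (Fin n × Fin n)`, `T = X none`) is a `VP` family over `ℂ`, then the Hamiltonian
cycle family `(HC_n)_n` is a `VP` family over `ℂ`: `HC` is a p-family (`isPFamily_hcPoly_holds`)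
and `L(HC_n) ≤ (n + 1)(L(P_n) + 1) + (n + 1) + 1` (`complexity_hcPoly_le`) is p-bounded when
`L(P_n)` is. The route's inline pencil is `fermionicPencilVar (Fin n) ℂ` definitionally. -/
theorem pencilControlsHC_proof :
    Summit.ValiantsHypothesis.ValiantsHypothesis.Theses.FermionicJet.PencilControlsHC := by
  unfold Summit.ValiantsHypothesis.ValiantsHypothesis.Theses.FermionicJet.PencilControlsHC
  intro h
  have hP : IsVPFamily (k := ℂ) (fun n => fermionicPencilVar (Fin n) ℂ) := h
  refine ⟨isPFamily_hcPoly_holds (k := ℂ), ?_⟩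
  have hL : IsPBounded (fun n => complexity (fermionicPencilVar (Fin n) ℂ)) := hP.2
  have h1 : IsPBounded (fun n : ℕ => n + 1) := IsPBounded.add_holds IsPBounded.id (IsPBounded.const 1)
  have hb : IsPBounded (fun n : ℕ =>
      (n + 1) * (complexity (fermionicPencilVar (Fin n) ℂ) + 1) + (n + 1) + 1) :=
    IsPBounded.add_holds (IsPBounded.add_holds
      (IsPBounded.mul_holds h1 (IsPBounded.add_holds hL (IsPBounded.const 1))) h1)
      (IsPBounded.const 1)
  exact hb.mono fun n => complexity_hcPoly_le n

end Summit.ValiantsHypothesis.ValiantsHypothesis.Theorems.FermionicJetPencilControlsHC
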